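import Summits.SmoothPoincare4.SmoothPoincare4.Theses.WeakReductionDescent
import Summits.SmoothPoincare4.SmoothPoincare4.Theses.GroupTrisection
import Summits.SmoothPoincare4.SmoothPoincare4.Theorems.WeakReductionDescentDependentTripleAtThreeOfGtriMorse1121

/-!
# `DependentTripleAtThree`, line `Sketch` — the apex stub `stub_gtriMorse1121` is SPC4-shielded, and sits above the crux

Negative lane of crux `WeakReductionDescent.DependentTripleAtThree` (item stmt-SmoothPoincare4-17999),
`-- Targets` section of the crux workfile `Cruxes/DependentTripleAtThree/Disproof.lean`
(seat refuter-cdisprove-stmt-SmoothPoincare4-17999-0, 2026-08-17).  The lead's registered skeleton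
`Cruxes/DependentTripleAtThree/Lines/Sketch.lean` closes the crux modulo two stubs:
`stub_factGKLemma13` (the tree's named fact `gkTrisection_exists_isMorse_isSelfIndexing`, Gay–Kirby
2016 Lemma 13 — a known theorem; its formal statement was audited against `Morse.lean`: `IsMorse` =
smooth + nondegenerate Hessian at critical points, `IsSelfIndexing` = `f x = index x`, no
distinct-critical-values clause, so multiplicities `k 0, g - k 1, k 2` are admissible; nothing to
refute) and `stub_gtriMorse1121` (= item stmt-SmoothPoincare4-0435 `GroupTrisection.GtriMorse1121`
verbatim).  About the latter, three kernel-checked remarks whose conclusions assert no route item: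

* `not_smoothPoincare4_of_not_stub_gtriMorse1121` — the apex is SPC4-SHIELDED like the crux: a
  refutation of it refutes the summit (SPC4 hands over the diffeomorphism; the Morse function is
  not even looked at).  No `stub_false` is possible short of an exotic 4-sphere.
* `exotic_of_not_stub_gtriMorse1121` — what a kill of the apex would be: a closed smooth homotopy
  4-sphere with a Morse function of profile `(1, ≤1, ·, ≤1, 1)` and no diffeomorphism to `S⁴`.
* `not_gtriMorse1121_of_not_dependentTripleAtThree` — crux ≤ apex modulo GK Lemma 13: a
  refutation of the crux refutes item 0435 (contrapositive of the landed certificate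
  `dependentTripleAtThree_of_gtriMorse1121`, p165900).  The converse arrow is NOT available: a
  `(1,1,2,1,1)` handle decomposition of a homotopy sphere yields `(g; 1, g−2, 1)` trisections with
  `g ≥ 3` unbounded (Gay–Kirby Thm 4 needs the attaching link in bridge position), while the crux
  (≡ the `(3;1,1,1)` frontier modulo AZ25 Thm 1.4, `dependentTripleAtThree_iff_noMinimalGenusThree`)
  only concerns `g = 3`; so the line's apex is a priori STRICTLY stronger than the crux (it is
  Property R for Mazur-type contractible pieces, Gompf arXiv:1603.05090 Q. 2.2), recorded for the
  planners, not a defect of the line.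
-/

noncomputable section

-- the registered namespace `Summit.SmoothPoincare4.SmoothPoincare4.Theorems` repeats a component
set_option linter.dupNamespace false

open scoped Manifold ContDiff Topology ContinuousMap
open Set Literature.Topology.FourManifolds
open Summit.SmoothPoincare4.SmoothPoincare4.Theses.WeakReductionDescent

namespace Summit.SmoothPoincare4.SmoothPoincare4.Theorems.DependentTripleAtThree.Negative

/-- **The apex stub is SPC4-shielded.** If `stub_gtriMorse1121` (the registered signature,
verbatim = item stmt-SmoothPoincare4-0435) fails then so does `SmoothPoincare4`: the summit gives
`M ≅ S⁴` for every smooth homotopy 4-sphere outright. [folklore] -/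
theorem not_smoothPoincare4_of_not_stub_gtriMorse1121
    (h : ¬ ∀ (M : Type) [TopologicalSpace M] [T2Space M] [SecondCountableTopology M] [ChartedSpace (EuclideanSpace ℝ (Fin 4)) M] [IsManifold (𝓡 4) ((⊤ : ℕ∞) : WithTop ℕ∞) M] [CompactSpace M], M ≃ₕ Metric.sphere (0 : EuclideanSpace ℝ (Fin 5)) 1 → ∀ f : M → ℝ, Literature.Topology.FourManifolds.IsMorse (𝓡 4) f → (Literature.Topology.FourManifolds.criticalSetOfIndex (𝓡 4) f 0).ncard = 1 → (Literature.Topology.FourManifolds.criticalSetOfIndex (𝓡 4) f 1).ncard ≤ 1 → (Literature.Topology.FourManifolds.criticalSetOfIndex (𝓡 4) f 3).ncard ≤ 1 → (Literature.Topology.FourManifolds.criticalSetOfIndex (𝓡 4) f 4).ncard = 1 → Nonempty (Diffeomorph (𝓡 4) (𝓡 4) M (Metric.sphere (0 : EuclideanSpace ℝ (Fin 5)) 1) ((⊤ : ℕ∞) : WithTop ℕ∞))) :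
    ¬ _root_.SmoothPoincare4 := by
  intro hS
  apply h
  intro M _ _ _ _ _ _ e _f _ _ _ _ _
  exact hS M ‹_› ‹_› e

/-- **What a kill of the apex would be**: a closed smooth homotopy 4-sphere carrying a Morse
function with one minimum, `≤ 1` critical point of index `1`, `≤ 1` of index `3` and one maximum,
and admitting no diffeomorphism to `S⁴` — an exotic 4-sphere of handle profile `(1, ≤1, ·, ≤1, 1)`.
[folklore] -/
theorem exotic_of_not_stub_gtriMorse1121
    (h : ¬ ∀ (M : Type) [TopologicalSpace M] [T2Space M] [SecondCountableTopology M] [ChartedSpace (EuclideanSpace ℝ (Fin 4)) M] [IsManifold (𝓡 4) ((⊤ : ℕ∞) : WithTop ℕ∞) M] [CompactSpace M], M ≃ₕ Metric.sphere (0 : EuclideanSpace ℝ (Fin 5)) 1 → ∀ f : M → ℝ, Literature.Topology.FourManifolds.IsMorse (𝓡 4) f → (Literature.Topology.FourManifolds.criticalSetOfIndex (𝓡 4) f 0).ncard = 1 → (Literature.Topology.FourManifolds.criticalSetOfIndex (𝓡 4) f 1).ncard ≤ 1 → (Literature.Topology.FourManifolds.criticalSetOfIndex (𝓡 4) f 3).ncard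 ≤ 1 → (Literature.Topology.FourManifolds.criticalSetOfIndex (𝓡 4) f 4).ncard = 1 → Nonempty (Diffeomorph (𝓡 4) (𝓡 4) M (Metric.sphere (0 : EuclideanSpace ℝ (Fin 5)) 1) ((⊤ : ℕ∞) : WithTop ℕ∞))) :
    ∃ (M : Type) (_ : TopologicalSpace M) (_ : T2Space M) (_ : SecondCountableTopology M)
      (_ : ChartedSpace (EuclideanSpace ℝ (Fin 4)) M) (_ : IsManifold (𝓡 4) ∞ M) (_ : CompactSpace M),
      Nonempty (M ≃ₕ (Metric.sphere (0 : EuclideanSpace ℝ (Fin 5)) 1)) ∧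
      (∃ f : M → ℝ, IsMorse (𝓡 4) f ∧ (criticalSetOfIndex (𝓡 4) f 0).ncard = 1 ∧
        (criticalSetOfIndex (𝓡 4) f 1).ncard ≤ 1 ∧ (criticalSetOfIndex (𝓡 4) f 3).ncard ≤ 1 ∧
        (criticalSetOfIndex (𝓡 4) f 4).ncard = 1) ∧
      IsEmpty (M ≃ₘ⟮𝓡 4, 𝓡 4⟯ (Metric.sphere (0 : EuclideanSpace ℝ (Fin 5)) 1)) := by
  refine Classical.byContradiction fun hcon => h ?_
  intro M _ _ _ _ _ _ e f hf c0 c1 c3 c4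
  refine Classical.byContradiction fun hno => ?_
  exact hcon ⟨M, inferInstance, inferInstance, inferInstance, inferInstance, inferInstance,
    inferInstance, ⟨e⟩, ⟨f, hf, c0, c1, c3, c4⟩, ⟨fun Φ => hno ⟨Φ⟩⟩⟩

/-- **Crux ≤ apex modulo GK Lemma 13**: a refutation of `DependentTripleAtThree` refutes item
stmt-SmoothPoincare4-0435 `GroupTrisection.GtriMorse1121` (contrapositive of the landed certificate
`dependentTripleAtThree_of_gtriMorse1121`). [cite: GayKirby2016, Lemma 13] -/
theorem not_gtriMorse1121_of_not_dependentTripleAtThree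
    (hGK : gkTrisection_exists_isMorse_isSelfIndexing) (h : ¬ DependentTripleAtThree) :
    ¬ Summit.SmoothPoincare4.SmoothPoincare4.Theses.GroupTrisection.GtriMorse1121 :=
  fun h0435 => h (dependentTripleAtThree_of_gtriMorse1121 hGK h0435)

end Summit.SmoothPoincare4.SmoothPoincare4.Theorems.DependentTripleAtThree.Negative

end
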